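import Summits.AtomisticToContinuum.Crystallization.Theorems.PalmUnimodularRigidityShellsToBarlowChartTransportSteps1
import Summits.AtomisticToContinuum.Crystallization.Theorems.PalmUnimodularRigidityShellsToBarlowChartTransportSteps5

/-!
# Line `develop-the-model-growth-descent` (crux `ShellsToBarlowChart`, stmt-AtomisticToContinuum-9227): the four in-layer transports `I, J, I⁻¹, J⁻¹` and the vertical transport `V` of frames read in integer charts (specifications, inverse identities, apexes) (part 6/7)

Helper lemmas for `stub_transportSystem` (the geometric half of the line): frames `⟨x, t₁, t₂, U⟩`
read in the integer charts `IsZChart` of a good-shell configuration, their transports and the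
coherence of the resulting development `frameAt`.  The only metric inputs are the chart transfer
lemma and `bond_nb_iff`; everything else is label combinatorics in `ℤ³` (pattern facts
`TransportPatterns*`).  All `[folklore]` (HalesDSP2012 §1.3 for the two kissing patterns).
-/

noncomputable section

namespace Summit.AtomisticToContinuum.Crystallization.Theorems.PalmUnimodularRigidityShellsToBarlowChart

open Literature.Geometry.DiscreteGeometry Literature.MathematicalPhysics.StatisticalMechanics
open Summit.AtomisticToContinuum.Crystallization.Theorems.ShellsToBarlowChartNegative

variable {S : Set (EuclideanSpace ℝ (Fin 3))} {ac : (EuclideanSpace ℝ (Fin 3)) → ℝ} {Pc : (EuclideanSpace ℝ (Fin 3)) → Finset (Fin 3 → ℤ)}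
  {Ac : (EuclideanSpace ℝ (Fin 3)) → ((EuclideanSpace ℝ (Fin 3)) →ₗᵢ[ℝ] (EuclideanSpace ℝ (Fin 3)))} {nb : (EuclideanSpace ℝ (Fin 3)) → (Fin 3 → ℤ) → (EuclideanSpace ℝ (Fin 3))}

/-- **`J ∘ J⁻¹ = id`** on valid frames in the admissible regime. [folklore] -/
theorem Jstep_JinvStep (hch : ∀ z ∈ S, IsZChart S z (ac z) (Pc z) (Ac z) (nb z)) {x : (EuclideanSpace ℝ (Fin 3))} (hx : x ∈ S) {t₁ t₂ : Fin 3 → ℤ} {U : Finset (Fin 3 → ℤ)} (hU : IsFrame (Pc x) t₁ t₂ U) (hreg : Pc (nb x (-t₂)) = fcc3Int ∨ Pc x = hcpInt ∨ (-zlab Pc nb (nb x (-t₂)) x ∈ Pc (nb x (-t₂)) ∧ -zlab Pc nb (nb x (-t₂)) (nb x (t₁ - t₂)) ∈ Pc (nb x (-t₂)))) : Jstep Pc nb (JinvStep Pc nb ⟨x, t₁, t₂, U⟩) = ⟨x, t₁, t₂, U⟩ := by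
  obtain ⟨hyS, -, -, hwx, -, hvK, -, -, -, -, -, -, -, cm, hcmU, -, -, hbu, -, -, hfilt'⟩ :=
    JinvStep_spec hch hx hU hreg
  have hUP : U ⊆ Pc x := hU.2.2.1
  have hnt₂ : -t₂ ∈ Pc x := hU.2.1 (mem_hexLabels_iff.2 (Or.inr (Or.inr (Or.inr (Or.inr (Or.inl rfl))))))
  have ht12 : t₁ - t₂ ∈ Pc x := hU.2.1 (mem_hexLabels_iff.2 (Or.inr (Or.inr (Or.inr (Or.inr (Or.inr rfl))))))
  have hμ := zlab_spec hch hyS (nb_mem hch hx (hUP hcmU)).1 hbu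
  set w := zlab Pc nb (nb x (-t₂)) x with hw_def
  set v := zlab Pc nb (nb x (-t₂)) (nb x (t₁ - t₂)) with hv_def
  set μ := zlab Pc nb (nb x (-t₂)) (nb x cm) with hμ_def
  set U' := (JinvStep Pc nb ⟨x, t₁, t₂, U⟩).U with hU'_def
  have hI : JinvStep Pc nb ⟨x, t₁, t₂, U⟩ = ⟨nb x (-t₂), v, w, U'⟩ := rfl
  have hf : U'.filter (fun e => sqNormInt (e - w) = 18) = {μ} := hfilt'
  rw [hI]
  simp only [Jstep]
  rw [hwx]
  rw [hf, Finset.image_singleton, hvK, hμ.2, zlab_nb hch hx hnt₂, zlab_nb hch hx ht12,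
    zlab_nb hch hx (hUP hcmU), neg_neg, show t₁ - t₂ - -t₂ = t₁ by abel,
    capWithAny_of_mem_cap hch hx hU hcmU]


/-! ## The vertical step -/

/-- The apex of a valid frame's upper cap is the label `c` of its translation form.
[folklore] -/
theorem apexOf_eq_of_form {P : Finset (Fin 3 → ℤ)} (hP : P = fcc3Int ∨ P = hcpInt)
    {t₁ t₂ c : Fin 3 → ℤ} {U : Finset (Fin 3 → ℤ)} (hU : IsFrame P t₁ t₂ U) (hcU : c ∈ U)
    (hform : U = {c, c - t₁, c - t₂} ∨ U = {c, c + t₁, c + t₂}) : apexOf t₁ t₂ U = c := by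
  obtain ⟨h12, hhex, hUP, hoff, -⟩ := hU
  have ht₁ : t₁ ∈ P := hhex (mem_hexLabels_iff.2 (Or.inl rfl))
  have ht₂ : t₂ ∈ P := hhex (mem_hexLabels_iff.2 (Or.inr (Or.inl rfl)))
  have hcP : c ∈ P := hUP hcU
  have hc : c ∉ hexLabels t₁ t₂ := hoff c hcU
  have hex : ∃ e ∈ U, (e - t₁ ∈ U ∧ e - t₂ ∈ U) ∨ (e + t₁ ∈ U ∧ e + t₂ ∈ U) := by
    refine ⟨c, hcU, ?_⟩
    rcases hform with hE | hO
    · left; rw [hE]; simp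
    · right; rw [hO]; simp
  rw [apexOf, dif_pos hex]
  obtain ⟨hmem, hcond⟩ := Classical.choose_spec hex
  rcases hform with hE | hO
  · have hc1 : c - t₁ ∈ P := hUP (by rw [hE]; simp)
    have hc2 : c - t₂ ∈ P := hUP (by rw [hE]; simp)
    have hmem' : Classical.choose hex ∈ ({c, c - t₁, c - t₂} : Finset (Fin 3 → ℤ)) := by
      rw [← hE]; exact hmem
    have hcond' : (Classical.choose hex - t₁ ∈ ({c, c - t₁, c - t₂} : Finset (Fin 3 → ℤ)) ∧
          Classical.choose hex - t₂ ∈ ({c, c - t₁, c - t₂} : Finset (Fin 3 → ℤ))) ∨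
        (Classical.choose hex + t₁ ∈ ({c, c - t₁, c - t₂} : Finset (Fin 3 → ℤ)) ∧
          Classical.choose hex + t₂ ∈ ({c, c - t₁, c - t₂} : Finset (Fin 3 → ℤ))) := by
      rw [← hE]; exact hcond
    exact apex_evenCap P hP t₁ ht₁ t₂ ht₂ c hcP h12 hhex hc hc1 hc2 _ hmem' hcond'
  · have hc1 : c + t₁ ∈ P := hUP (by rw [hO]; simp)
    have hc2 : c + t₂ ∈ P := hUP (by rw [hO]; simp)
    have hmem' : Classical.choose hex ∈ ({c, c + t₁, c + t₂} : Finset (Fin 3 → ℤ)) := by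
      rw [← hO]; exact hmem
    have hcond' : (Classical.choose hex - t₁ ∈ ({c, c + t₁, c + t₂} : Finset (Fin 3 → ℤ)) ∧
          Classical.choose hex - t₂ ∈ ({c, c + t₁, c + t₂} : Finset (Fin 3 → ℤ))) ∨
        (Classical.choose hex + t₁ ∈ ({c, c + t₁, c + t₂} : Finset (Fin 3 → ℤ)) ∧
          Classical.choose hex + t₂ ∈ ({c, c + t₁, c + t₂} : Finset (Fin 3 → ℤ))) := by
      rw [← hO]; exact hcond
    exact apex_oddCap P hP t₁ ht₁ t₂ ht₂ c hcP h12 hhex hc hc1 hc2 _ hmem' hcond'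

/-- Upper-cap labels of a valid frame are polar when the pattern is HCP, symmetric when it is
FCC: `−e ∉ P ∨ every label of P is symmetric`. [folklore] -/
theorem cap_label_polar_or_fcc {P : Finset (Fin 3 → ℤ)} (hP : P = fcc3Int ∨ P = hcpInt)
    {t₁ t₂ : Fin 3 → ℤ} {U : Finset (Fin 3 → ℤ)} (hU : IsFrame P t₁ t₂ U) {e : Fin 3 → ℤ}
    (he : e ∈ U) : (-e ∉ P) ∨ (∀ z ∈ P, -z ∈ P) := by
  rcases hP with rfl | rfl
  · exact Or.inr (fun z hz => neg_mem_fcc3Int z hz)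
  · left
    obtain ⟨h12, hhex, hUP, hoff, c, hcU, hform⟩ := hU
    have ht₁ : t₁ ∈ hcpInt := hhex (mem_hexLabels_iff.2 (Or.inl rfl))
    have ht₂ : t₂ ∈ hcpInt := hhex (mem_hexLabels_iff.2 (Or.inr (Or.inl rfl)))
    have hcP : c ∈ hcpInt := hUP hcU
    have hc : c ∉ hexLabels t₁ t₂ := hoff c hcU
    rcases hform with hE | hO
    · have hc1 : c - t₁ ∈ hcpInt := hUP (by rw [hE]; simp)
      have hc2 : c - t₂ ∈ hcpInt := hUP (by rw [hE]; simp)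
      obtain ⟨h0, h1, h2⟩ := cap_not_symm_hcp_even t₁ ht₁ t₂ ht₂ c hcP h12 hhex hc hc1 hc2
      rw [hE] at he
      simp only [Finset.mem_insert, Finset.mem_singleton] at he
      rcases he with rfl | rfl | rfl
      exacts [h0, h1, h2]
    · have hc1 : c + t₁ ∈ hcpInt := hUP (by rw [hO]; simp)
      have hc2 : c + t₂ ∈ hcpInt := hUP (by rw [hO]; simp)
      obtain ⟨h0, h1, h2⟩ := cap_not_symm_hcp_odd t₁ ht₁ t₂ ht₂ c hcP h12 hhex hc hc1 hc2
      rw [hO] at he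
      simp only [Finset.mem_insert, Finset.mem_singleton] at he
      rcases he with rfl | rfl | rfl
      exacts [h0, h1, h2]

/-- **Polarity at the apex.**  If a site `u = nb x c` is attached to `x` through an upper-cap
label `c` of a valid frame at `x`, and `u` is HCP, then `x` is POLAR at `u` (the label of `x`
at `u` is not symmetric): otherwise the mirror pair touching that label would be two common
neighbours of `x, u` read at `x` at squared distance `48` around the cap label `c`.
[folklore] -/
theorem polar_at_apex (hch : ∀ z ∈ S, IsZChart S z (ac z) (Pc z) (Ac z) (nb z)) {x : (EuclideanSpace ℝ (Fin 3))} (hx : x ∈ S)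
    {t₁ t₂ : Fin 3 → ℤ} {U : Finset (Fin 3 → ℤ)} (hU : IsFrame (Pc x) t₁ t₂ U)
    {c : Fin 3 → ℤ} (hcU : c ∈ U) (hhcp : Pc (nb x c) = hcpInt) :
    -zlab Pc nb (nb x c) x ∉ Pc (nb x c) := by
  intro hneg
  have hcP : c ∈ Pc x := hU.2.2.1 hcU
  have hu := nb_mem hch hx hcP
  have hξ := zlab_spec hch hu.1 hx (bond_symm hu.2)
  set ξ := zlab Pc nb (nb x c) x with hξ_def
  have hξP : ξ ∈ hcpInt := by rw [← hhcp]; exact hξ.1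
  rw [hhcp] at hneg
  obtain ⟨m, hm, n, hn, hξm, hξn, hmn⟩ := exists_mirror_pair_of_equatorial ξ hξP hneg
  have hmP : m ∈ Pc (nb x c) := by rw [hhcp]; exact hm
  have hnP : n ∈ Pc (nb x c) := by rw [hhcp]; exact hn
  -- the two mirror neighbours are common neighbours of `x` and `u`
  have hzm := nb_mem hch hu.1 hmP
  have hzn := nb_mem hch hu.1 hnP
  have hbm : 0 < dist (nb (nb x c) m) x ∧ dist (nb (nb x c) m) x ≤ 28 / 25 := by
    have := (bond_nb_iff hch hu.1 hmP hξ.1).2 (by rw [sqNormInt_sub_comm]; exact hξm)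
    rwa [hξ.2] at this
  have hbn : 0 < dist (nb (nb x c) n) x ∧ dist (nb (nb x c) n) x ≤ 28 / 25 := by
    have := (bond_nb_iff hch hu.1 hnP hξ.1).2 (by rw [sqNormInt_sub_comm]; exact hξn)
    rwa [hξ.2] at this
  -- their labels at `x`
  have ha := zlab_spec hch hx hzm.1 (bond_symm hbm)
  have hb := zlab_spec hch hx hzn.1 (bond_symm hbn)
  set a := zlab Pc nb x (nb (nb x c) m) with ha_def
  set b := zlab Pc nb x (nb (nb x c) n) with hb_def
  -- both touch `c`
  have hac : sqNormInt (a - c) = 18 := by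
    have := (bond_nb_iff hch hx ha.1 hcP).1 (by rw [ha.2]; exact bond_symm hzm.2)
    exact this
  have hbc : sqNormInt (b - c) = 18 := by
    have := (bond_nb_iff hch hx hb.1 hcP).1 (by rw [hb.2]; exact bond_symm hzn.2)
    exact this
  -- transfer `x → u` of the pair: `48`
  have htr := transfer_nb_nb hch hx hu.1 hu.2 ha.1 hb.1 (by rw [ha.2]; exact hzm.2)
    (by rw [hb.2]; exact hzn.2)
  rw [ha.2, hb.2, zlab_nb hch hu.1 hmP, zlab_nb hch hu.1 hnP, hmn] at htr
  exact no_48_around_polar (Pc x) (pattern_cases hch hx) c hcP a ha.1 b hb.1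
    (cap_label_polar_or_fcc (pattern_cases hch hx) hU hcU)
    (by rw [sqNormInt_sub_comm]; exact hac) (by rw [sqNormInt_sub_comm]; exact hbc) htr.symm

/-- **One-sidedness at a common apex.**  Two sites attached to the same site `u` through
upper-cap labels of valid frames are on one side at `u`: their labels at `u` are both symmetric
(FCC) or both polar (HCP). [folklore] -/
theorem onesided_at_apex (hch : ∀ z ∈ S, IsZChart S z (ac z) (Pc z) (Ac z) (nb z)) {x x' : (EuclideanSpace ℝ (Fin 3))}
    (hx : x ∈ S) (hx' : x' ∈ S) {t₁ t₂ t₁' t₂' : Fin 3 → ℤ} {U U' : Finset (Fin 3 → ℤ)}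
    (hU : IsFrame (Pc x) t₁ t₂ U) (hU' : IsFrame (Pc x') t₁' t₂' U') {c c' : Fin 3 → ℤ}
    (hcU : c ∈ U) (hcU' : c' ∈ U') (heq : nb x c = nb x' c') :
    (-zlab Pc nb (nb x c) x ∈ Pc (nb x c) ∧ -zlab Pc nb (nb x c) x' ∈ Pc (nb x c)) ∨
      (-zlab Pc nb (nb x c) x ∉ Pc (nb x c) ∧ -zlab Pc nb (nb x c) x' ∉ Pc (nb x c)) := by
  have hcP : c ∈ Pc x := hU.2.2.1 hcU
  have hcP' : c' ∈ Pc x' := hU'.2.2.1 hcU'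
  have hu := nb_mem hch hx hcP
  have hu' := nb_mem hch hx' hcP'
  have hξ := zlab_spec hch hu.1 hx (bond_symm hu.2)
  have hξ' := zlab_spec hch hu.1 hx' (by rw [heq]; exact bond_symm hu'.2)
  rcases pattern_cases hch hu.1 with hF | hH
  · left
    rw [hF] at hξ hξ' ⊢
    exact ⟨neg_mem_fcc3Int _ hξ.1, neg_mem_fcc3Int _ hξ'.1⟩
  · right
    refine ⟨polar_at_apex hch hx hU hcU hH, ?_⟩
    have := polar_at_apex hch hx' hU' hcU' (by rw [← heq]; exact hH)
    rwa [← heq] at this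

end Summit.AtomisticToContinuum.Crystallization.Theorems.PalmUnimodularRigidityShellsToBarlowChart

end
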